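import Mathlib
import Summits.ValiantsHypothesis.ValiantsHypothesis.Theorems.RigidityForcesSymmetryRankRigidMinimalReprLaplaceFiveThreeSlicesNormalize

/-!
# `LaplaceOptimalFive`, two slices: normalisation of the data to a sorted labelled configuration
# (crux `RankRigidMinimalRepr`, stmt-ValiantsHypothesis-18034; frontier rung `LaplaceOptimalFive`, stmt-24813)

After the `a = 4` and `a = 3` classes (`laplace_five_at_most_two_slices`, p618638) the next class of the programme on
`LaplaceOptimal 5` is `a = 2`: two slices and at most five pair terms.  `two_slices_normalize` is the `a = 2` twin of p8 g11's
`three_slices_normalize`: in the data format of `LaplaceOptimal 5` — split-rank-one terms summing to `[v injective]` on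
`Fin 5 → Fin 5` with total Laplace weight `< 120`, EXACTLY two of them slices (`|S_t| ∈ {1,4}`) — the identity takes, after a
slot relabelling, re-indexing, orientation and sorting of the pair cuts and zero-padding, the SORTED LABELLED form

  `[v injective] = Σ_{k<2} α_k(v_{I c k}) · W_k(v) + Σ_{t<5} u_t(v) · w_t(v)`,

slice slots `I c = (0,1) | (0,0)` (`c : Fin 2`), `W_k` blind to slot `I c k`, pair cuts `p t < q t` lexicographically
non-decreasing in `t`, `u_t` a function of `(v_{p t}, v_{q t})`, `w_t` blind to both.  These sorted labelled configurations index
the `a = 2` census (350 profile types; memo on the item) — the kill files (certificate tables, `…LaplaceContractRectFive.lean`)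
and the residual list consume exactly this shape.  Ingredients: `slice_normal_form` / `pair_normal_form`, the kernel search
`slot_pattern_search_two`, and `pair_sort` (any number of cuts, by `Tuple.sort` on the lexicographic order — the three-cut
`decide` of the `a = 3` file does not scale to five cuts).

HONEST FRAMING: bookkeeping toward an exact PARTIAL result on the frontier rung `LaplaceOptimalFive` (stmt-24813); the item
stays OPEN; nothing here bears on `VP ≠ VNP`.
-/

set_option autoImplicit false

-- the mandated summit-side namespace repeats a component by design (single-problem summit)
set_option linter.dupNamespace false

namespace Summit.ValiantsHypothesis.ValiantsHypothesis.Theorems.RigidityForcesSymmetryRankRigidMinimalRepr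

namespace LaplaceFiveSlices

open Finset

/-! ### §1 The kernel search and the sort -/

/-- Every slot map `i : Fin 2 → Fin 5` is, up to a permutation of the slots and a re-indexing, one of the two patterns
`(0,1)`, `(0,0)`. -/
theorem slot_pattern_search_two : ∀ i : Fin 2 → Fin 5, ∃ σ : Equiv.Perm (Fin 5), ∃ κ : Equiv.Perm (Fin 2),
    ∃ c : Fin 2, ∀ k, σ (i (κ k)) = (![![0, 1], ![0, 0]] : Fin 2 → Fin 2 → Fin 5) c k := by
  decide +kernel

/-- Any family of oriented pairs can be re-indexed in lexicographically non-decreasing order (`Tuple.sort` on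
`Fin 5 ×ₗ Fin 5`). -/
theorem pair_sort {n : ℕ} (p q : Fin n → Fin 5) : ∃ κ : Equiv.Perm (Fin n),
    ∀ t t' : Fin n, t < t' → p (κ t) < p (κ t') ∨ (p (κ t) = p (κ t') ∧ q (κ t) ≤ q (κ t')) := by
  refine ⟨Tuple.sort (fun t => toLex (p t, q t)), fun t t' htt' => ?_⟩
  have h := Tuple.monotone_sort (fun t => toLex (p t, q t)) htt'.le
  simp only [Function.comp_apply] at h
  exact Prod.Lex.toLex_le_toLex.mp h

/-! ### §2 The normalisation -/

/-- **Two slices: sorted labelled normal form.**  In the data format of `LaplaceOptimal 5`: if the terms sum to the pattern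
with total Laplace weight `< 120` and exactly two of them are slices, then for some slot pattern `I c ∈ {(0,1), (0,0)}` and
sorted oriented pair cuts `p t < q t` (`t < 5`, zero terms allowed) the pattern is
`Σ_k α_k(v_{I c k}) · W_k(v) + Σ_t u_t(v) · w_t(v)` with `W_k` blind to slot `I c k`, `u_t` a function of `(v_{p t}, v_{q t})`
and `w_t` blind to `p t, q t`. -/
theorem two_slices_normalize {N : ℕ} (T : Finset (Fin N)) (S : Fin N → Finset (Fin 5))
    (u w : Fin N → (Fin 5 → Fin 5) → ℂ)
    (hu : ∀ t, ∀ v v' : Fin 5 → Fin 5, (∀ i ∈ S t, v i = v' i) → u t v = u t v')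
    (hw : ∀ t, ∀ v v' : Fin 5 → Fin 5, (∀ i, i ∉ S t → v i = v' i) → w t v = w t v')
    (hsum : ∀ v : Fin 5 → Fin 5, (∑ t ∈ T, u t v * w t v) = if Function.Injective v then 1 else 0)
    (hlt : ∑ t ∈ T, (S t).card.factorial * (5 - (S t).card).factorial < 120)
    (h2 : (T.filter (fun t => (S t).card = 1 ∨ (S t).card = 4)).card = 2) :
    ∃ (c : Fin 2) (α : Fin 2 → Fin 5 → ℂ) (W : Fin 2 → (Fin 5 → Fin 5) → ℂ) (p q : Fin 5 → Fin 5)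
      (u' w' : Fin 5 → (Fin 5 → Fin 5) → ℂ),
      (∀ k, ∀ v v' : Fin 5 → Fin 5,
        (∀ j, j ≠ (![![0, 1], ![0, 0]] : Fin 2 → Fin 2 → Fin 5) c k → v j = v' j) → W k v = W k v') ∧
      (∀ t, p t < q t) ∧
      (∀ t t' : Fin 5, t < t' → p t < p t' ∨ (p t = p t' ∧ q t ≤ q t')) ∧
      (∀ t, ∀ v v' : Fin 5 → Fin 5, v (p t) = v' (p t) → v (q t) = v' (q t) → u' t v = u' t v') ∧
      (∀ t, ∀ v v' : Fin 5 → Fin 5, (∀ j, j ≠ p t → j ≠ q t → v j = v' j) → w' t v = w' t v') ∧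
      ∀ v : Fin 5 → Fin 5, (if Function.Injective v then (1 : ℂ) else 0) =
        (∑ k, α k (v ((![![0, 1], ![0, 0]] : Fin 2 → Fin 2 → Fin 5) c k)) * W k v) +
          ∑ t, u' t v * w' t v := by
  classical
  set I : Fin 2 → Fin 2 → Fin 5 := ![![0, 1], ![0, 0]] with hI
  -- every term is a slice or a pair term (weight of a single term < 120)
  have hwt : ∀ t ∈ T, (S t).card.factorial * (5 - (S t).card).factorial < 120 := fun t ht =>
    lt_of_le_of_lt (single_le_sum (f := fun t => (S t).card.factorial * (5 - (S t).card).factorial)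
      (fun _ _ => Nat.zero_le _) ht) hlt
  have hcard5 : ∀ t, (S t).card ≤ 5 := fun t => (card_le_univ _).trans (by simp)
  have htype : ∀ t ∈ T, ((S t).card = 1 ∨ (S t).card = 4) ∨ ((S t).card = 2 ∨ (S t).card = 3) := by
    intro t ht
    have h1 := hwt t ht
    have h2 := hcard5 t
    interval_cases hc : (S t).card <;> simp_all (config := {decide := true})
  set Sl := T.filter (fun t => (S t).card = 1 ∨ (S t).card = 4) with hSl
  set Pr := T.filter (fun t => (S t).card = 2 ∨ (S t).card = 3) with hPr
  have hdisj : Disjoint Sl Pr := by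
    rw [hSl, hPr, disjoint_filter]; intro t _ h1 h2; omega
  have hunion : T = Sl ∪ Pr := by
    ext t
    simp only [hSl, hPr, mem_union, mem_filter]
    constructor
    · intro ht; rcases htype t ht with h | h
      · exact Or.inl ⟨ht, h⟩
      · exact Or.inr ⟨ht, h⟩
    · rintro (⟨ht, -⟩ | ⟨ht, -⟩) <;> exact ht
  -- the weight: 24 |Sl| + 12 |Pr| < 120, so |Pr| ≤ 5
  have hweight : 24 * Sl.card + 12 * Pr.card < 120 := by
    have e1 : ∑ t ∈ Sl, (S t).card.factorial * (5 - (S t).card).factorial = 24 * Sl.card := by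
      rw [mul_comm, ← smul_eq_mul, ← sum_const]
      refine sum_congr rfl fun t ht => ?_
      rw [hSl, mem_filter] at ht
      rcases ht.2 with h | h <;> rw [h] <;> decide
    have e2 : ∑ t ∈ Pr, (S t).card.factorial * (5 - (S t).card).factorial = 12 * Pr.card := by
      rw [mul_comm, ← smul_eq_mul, ← sum_const]
      refine sum_congr rfl fun t ht => ?_
      rw [hPr, mem_filter] at ht
      rcases ht.2 with h | h <;> rw [h] <;> decide
    rw [hunion, sum_union hdisj, e1, e2] at hlt
    exact hlt
  have hSl2 : Sl.card = 2 := h2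
  have hPr5 : Pr.card ≤ 5 := by omega
  -- normal forms of the two slices
  have key : ∀ x : Sl, ∃ (s : Fin 5) (α : Fin 5 → ℂ) (W : (Fin 5 → Fin 5) → ℂ),
      (∀ v v' : Fin 5 → Fin 5, (∀ j, j ≠ s → v j = v' j) → W v = W v') ∧
      ∀ v, u x v * w x v = α (v s) * W v := fun x =>
    slice_normal_form (S x) (u x) (w x) (hu x) (hw x) (by
      have hx : (x : Fin N) ∈ T.filter (fun t => (S t).card = 1 ∨ (S t).card = 4) := x.2
      exact (mem_filter.mp hx).2)
  choose slot α W hWb hterm using key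
  have hcardSl : Fintype.card Sl = 2 := by rw [Fintype.card_coe, hSl2]
  let e : Sl ≃ Fin 2 := Fintype.equivFinOfCardEq hcardSl
  -- normal forms of the pair terms
  have keyP : ∀ x : Pr, ∃ (p q : Fin 5) (u' w' : (Fin 5 → Fin 5) → ℂ), p ≠ q ∧
      (∀ v v' : Fin 5 → Fin 5, v p = v' p → v q = v' q → u' v = u' v') ∧
      (∀ v v' : Fin 5 → Fin 5, (∀ j, j ≠ p → j ≠ q → v j = v' j) → w' v = w' v') ∧
      ∀ v, u x v * w x v = u' v * w' v := fun x =>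
    pair_normal_form (S x) (u x) (w x) (hu x) (hw x) (by
      have hx : (x : Fin N) ∈ T.filter (fun t => (S t).card = 2 ∨ (S t).card = 3) := x.2
      exact (mem_filter.mp hx).2)
  choose pp qq uu ww hpq huu hww hpterm using keyP
  set m := Pr.card with hm
  have hcardPr : Fintype.card Pr = m := by rw [Fintype.card_coe]
  let eP : Pr ≃ Fin m := Fintype.equivFinOfCardEq hcardPr
  -- padding to exactly five pair terms (zero terms on the cut `{0, 1}`)
  let P : Fin 5 → Fin 5 := fun t => if h : (t : ℕ) < m then pp (eP.symm ⟨t, h⟩) else 0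
  let Q : Fin 5 → Fin 5 := fun t => if h : (t : ℕ) < m then qq (eP.symm ⟨t, h⟩) else 1
  let U : Fin 5 → (Fin 5 → Fin 5) → ℂ := fun t => if h : (t : ℕ) < m then uu (eP.symm ⟨t, h⟩) else 0
  let V : Fin 5 → (Fin 5 → Fin 5) → ℂ := fun t => if h : (t : ℕ) < m then ww (eP.symm ⟨t, h⟩) else 0
  have hPQ : ∀ t, P t ≠ Q t := by
    intro t
    by_cases h : (t : ℕ) < m
    · simp only [P, Q, dif_pos h]; exact hpq _
    · simp only [P, Q, dif_neg h]; decide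
  have hU : ∀ t, ∀ v v' : Fin 5 → Fin 5, v (P t) = v' (P t) → v (Q t) = v' (Q t) → U t v = U t v' := by
    intro t v v' h1 h2
    by_cases h : (t : ℕ) < m
    · simp only [P, Q, U, dif_pos h] at h1 h2 ⊢; exact huu _ v v' h1 h2
    · simp only [U, dif_neg h]; rfl
  have hV : ∀ t, ∀ v v' : Fin 5 → Fin 5, (∀ j, j ≠ P t → j ≠ Q t → v j = v' j) → V t v = V t v' := by
    intro t v v' hvv'
    by_cases h : (t : ℕ) < m
    · simp only [P, Q, V, dif_pos h] at hvv' ⊢; exact hww _ v v' hvv'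
    · simp only [V, dif_neg h]; rfl
  have hUV : ∀ v, ∑ t, U t v * V t v = ∑ x ∈ Pr, u x v * w x v := by
    intro v
    have hfilter : (univ.filter (fun t : Fin 5 => (t : ℕ) < m)) = (univ : Finset (Fin m)).map (Fin.castLEEmb hPr5) := by
      ext t
      simp only [mem_filter, mem_univ, true_and, mem_map, Fin.castLEEmb_apply]
      constructor
      · intro ht; exact ⟨⟨t, ht⟩, Fin.ext rfl⟩
      · rintro ⟨s, rfl⟩; exact s.isLt
    have h1 : ∑ t, U t v * V t v = ∑ t ∈ univ.filter (fun t : Fin 5 => (t : ℕ) < m), U t v * V t v := by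
      rw [sum_filter]
      refine Fintype.sum_congr _ _ (fun t => ?_)
      by_cases h : (t : ℕ) < m
      · rw [if_pos h]
      · rw [if_neg h]; simp only [U, dif_neg h]; simp
    rw [h1, hfilter, sum_map, ← sum_coe_sort Pr]
    rw [← Fintype.sum_equiv eP.symm (fun s => U (Fin.castLEEmb hPr5 s) v * V (Fin.castLEEmb hPr5 s) v)
      (fun x => u x v * w x v) (fun s => ?_)]
    rw [hpterm]
    have hs : ((Fin.castLEEmb hPr5 s : Fin 5) : ℕ) < m := s.isLt
    have hs' : (⟨((Fin.castLEEmb hPr5 s : Fin 5) : ℕ), hs⟩ : Fin m) = s := Fin.ext rfl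
    simp only [U, V, dif_pos hs, hs']
  -- the identity in padded normal form
  have H : ∀ v : Fin 5 → Fin 5, (if Function.Injective v then (1 : ℂ) else 0) =
      (∑ k : Fin 2, α (e.symm k) (v (slot (e.symm k))) * W (e.symm k) v) + ∑ t, U t v * V t v := by
    intro v
    rw [← hsum v, hunion, sum_union hdisj, hUV v]
    congr 1
    rw [← sum_coe_sort Sl]
    simp only [hterm]
    exact Fintype.sum_equiv e _ _ (fun x => by simp)
  -- relabel the slots: the slice slots become the pattern `I c`
  obtain ⟨σ, κ, c, hσ⟩ := slot_pattern_search_two (fun k => slot (e.symm k))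
  have hσ' : ∀ k, σ (slot (e.symm (κ k))) = I c k := hσ
  -- oriented relabelled pair cuts
  let p₁ : Fin 5 → Fin 5 := fun t => min (σ (P t)) (σ (Q t))
  let q₁ : Fin 5 → Fin 5 := fun t => max (σ (P t)) (σ (Q t))
  have hσPQ : ∀ t, σ (P t) ≠ σ (Q t) := fun t h => hPQ t (σ.injective h)
  have hpq₁ : ∀ t, p₁ t < q₁ t := fun t => min_lt_max.mpr (hσPQ t)
  have hpair₁ : ∀ t, ∀ v v' : Fin 5 → Fin 5, v (p₁ t) = v' (p₁ t) → v (q₁ t) = v' (q₁ t) →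
      v (σ (P t)) = v' (σ (P t)) ∧ v (σ (Q t)) = v' (σ (Q t)) := by
    intro t v v' h1 h2
    simp only [p₁, q₁] at h1 h2
    rcases le_total (σ (P t)) (σ (Q t)) with h | h
    · rw [min_eq_left h] at h1; rw [max_eq_right h] at h2; exact ⟨h1, h2⟩
    · rw [min_eq_right h] at h1; rw [max_eq_left h] at h2; exact ⟨h2, h1⟩
  have hoff₁ : ∀ t j, j ≠ p₁ t → j ≠ q₁ t → j ≠ σ (P t) ∧ j ≠ σ (Q t) := by
    intro t j h1 h2
    simp only [p₁, q₁] at h1 h2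
    rcases le_total (σ (P t)) (σ (Q t)) with h | h
    · rw [min_eq_left h] at h1; rw [max_eq_right h] at h2; exact ⟨h1, h2⟩
    · rw [min_eq_right h] at h1; rw [max_eq_left h] at h2; exact ⟨h2, h1⟩
  -- sort the pair cuts
  obtain ⟨κ₂, hκ₂⟩ := pair_sort p₁ q₁
  refine ⟨c, fun k => α (e.symm (κ k)), fun k v => W (e.symm (κ k)) (v ∘ σ), fun t => p₁ (κ₂ t), fun t => q₁ (κ₂ t),
    fun t v => U (κ₂ t) (v ∘ σ), fun t v => V (κ₂ t) (v ∘ σ), ?_, fun t => hpq₁ (κ₂ t), hκ₂, ?_, ?_, ?_⟩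
  · -- `W` blind to the relabelled slot
    intro k v v' hvv'
    refine hWb (e.symm (κ k)) _ _ (fun j hj => ?_)
    simp only [Function.comp_apply]
    exact hvv' (σ j) (fun h => hj (σ.injective (h.trans (hσ' k).symm)))
  · -- `u'` depends on the two cut slots only
    intro t v v' h1 h2
    obtain ⟨e1, e2⟩ := hpair₁ (κ₂ t) v v' h1 h2
    exact hU (κ₂ t) _ _ (by simpa using e1) (by simpa using e2)
  · -- `w'` blind to the two cut slots
    intro t v v' hvv'
    refine hV (κ₂ t) _ _ (fun j hjP hjQ => ?_)
    simp only [Function.comp_apply]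
    have hne : σ j ≠ p₁ (κ₂ t) ∧ σ j ≠ q₁ (κ₂ t) := by
      constructor
      · intro h
        simp only [p₁] at h
        rcases le_total (σ (P (κ₂ t))) (σ (Q (κ₂ t))) with hle | hle
        · rw [min_eq_left hle] at h; exact hjP (σ.injective h)
        · rw [min_eq_right hle] at h; exact hjQ (σ.injective h)
      · intro h
        simp only [q₁] at h
        rcases le_total (σ (P (κ₂ t))) (σ (Q (κ₂ t))) with hle | hle
        · rw [max_eq_right hle] at h; exact hjQ (σ.injective h)
        · rw [max_eq_left hle] at h; exact hjP (σ.injective h)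
    exact hvv' (σ j) hne.1 hne.2
  · -- the identity
    intro v
    have Hv := H (v ∘ σ)
    have Hv' : (if Function.Injective v then (1 : ℂ) else 0) =
        (∑ k : Fin 2, α (e.symm k) ((v ∘ σ) (slot (e.symm k))) * W (e.symm k) (v ∘ σ)) +
          ∑ t, U t (v ∘ σ) * V t (v ∘ σ) := by
      by_cases hv : Function.Injective v
      · rw [if_pos hv]; rw [if_pos ((injective_comp_perm_iff σ v).mpr hv)] at Hv; exact Hv
      · rw [if_neg hv]; rw [if_neg (fun h => hv ((injective_comp_perm_iff σ v).mp h))] at Hv; exact Hv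
    rw [Hv']
    congr 1
    · rw [← Equiv.sum_comp κ]
      refine Fintype.sum_congr _ _ (fun k => ?_)
      simp only [Function.comp_apply]
      rw [hσ' k]
    · simp only []
      exact (Equiv.sum_comp κ₂ (fun t => U t (v ∘ σ) * V t (v ∘ σ))).symm

end LaplaceFiveSlices

end Summit.ValiantsHypothesis.ValiantsHypothesis.Theorems.RigidityForcesSymmetryRankRigidMinimalRepr
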